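import Summits.QuantumFields.YangMills.Theses.FemtoCutoffLadder
import Summits.QuantumFields.YangMills.Theorems.FemtoCutoffLadderDyadicNestedUpperOfDeficitRG
import Summits.QuantumFields.YangMills.Theorems.FemtoCutoffLadderDyadicNestedUpperDirichlet
import Summits.QuantumFields.YangMills.Theorems.FemtoTransferGapEigenbasis

set_option autoImplicit false

noncomputable section

/-!
# FemtoCutoffLadder — glue for LINE g5-B «pinned pull-back of the coarse excitation»

`dyadicNestedUpper_of_blockedExcitationPersistence :
  BlockedExcitationPersistence → DyadicNestedUpper`.

The route item `BlockedExcitationPersistence` (stmt-QuantumFields-26477, crux r407 of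
`route-QuantumFields-FemtoCutoffLadder`) PINS the trial multiplier of the deficit/RG reduction
`dyadicNestedUpper_of_trialDeficitRG` (seat ym-line-sfw-p1) to `g := (φ' / Ω') ∘ B`, where `B` is the
straight-transporter block link map written inline as an ordered `List.ofFn` product of the `2 ^ k`
fine links, `Ω'` is the exact positive coarse ground state and `φ'` an exact coarse first-excited
eigenfunction.  This file discharges everything except the item itself:

* `transport_replicate_eq_prod_ofFn` identifies the inline block product with
  `transport U c (List.replicate M i)` of `BlockPullback`;
* existence of `Ω'`, `c'`, `φ'` from `PhysL2.exists_groundState`, `exists_isPhys_eigenseq`,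
  `levelValue_one`, orthogonality from `Dirichlet.l2_eq_zero_of_eigen_ne` and
  `PhysL2.secondValue_lt_topValue`;
* admissibility of `g` from `Dirichlet.ratio_multiplier` and `Dirichlet.pullback_multiplier`;
* then `dyadicNestedUpper_of_trialDeficitRG`.

No summit is proved here: the theorem is an implication from an OPEN route item.
-/

open MeasureTheory
open Literature.MathematicalPhysics.QuantumFieldTheory (GaugeConfig Site Edge gaugeTransform)
open Literature.MathematicalPhysics.QuantumLattice

namespace Summit.QuantumFields.YangMills.Theorems.FemtoCutoffLadder

open Summit.QuantumFields.YangMills.Theorems.FemtoTransferGap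
open Summit.QuantumFields.YangMills.Theses.FemtoCutoffLadder

/-- **Bridging the vocabularies**: the straight transporter of `M` links in direction `i` from `c` (the block link map of
`…DyadicNestedUpperPullback`, `transport U c (List.replicate M i)`) is the ordered product written inline in the route item. [folklore] -/
theorem transport_replicate_eq_prod_ofFn {G : Type*} [Monoid G] {n : ℕ} (U : GaugeConfig 3 n G) (c : Site 3 n) (i : Fin 3) (M : ℕ) :
    transport U c (List.replicate M i) = (List.ofFn fun t : Fin M => U (c + Pi.single i ((t : ℕ) : ZMod n), i)).prod := by
  induction M generalizing c with
  | zero => simp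
  | succ M ih =>
    rw [BlockPullback.transport_replicate_succ, ih, List.ofFn_succ, List.prod_cons]
    congr 1
    · simp
    · congr 1
      rw [List.ofFn_inj]
      funext t
      rw [Fin.val_succ, Site.shift, add_assoc, ← Pi.single_add, Nat.cast_succ, add_comm (1 : ZMod n)]

/-- ★★★ **LINE g5-B glues**: `BlockedExcitationPersistence → DyadicNestedUpper`.  The pinned trial multiplier — the pull-back
`(φ₁'/Ω') ∘ B_{2^k}` of the ratio of the two top COARSE physical eigenfunctions along the straight-transporter block map — is fed into
`dyadicNestedUpper_of_trialDeficitRG` (seat ym-line-sfw-p1 g10): admissibility by `Dirichlet.ratio_multiplier` + `Dirichlet.pullback_multiplier`,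
the coarse eigenfunctions from `PhysL2.exists_groundState` / `exists_isPhys_eigenseq` (`levelValue 1 = secondValue`, orthogonality by
`Dirichlet.l2_eq_zero_of_eigen_ne` + `secondValue_lt_topValue`). [cite: ReedSimonIV1978, Thm. XIII.1] [cite: Balaban1985Averaging] -/
theorem dyadicNestedUpper_of_blockedExcitationPersistence (h : BlockedExcitationPersistence) : DyadicNestedUpper := by
  obtain ⟨C, lam0, L0, hlam0, H⟩ := h
  apply dyadicNestedUpper_of_trialDeficitRG
  refine ⟨C, lam0, L0, hlam0, ?_⟩
  intro lam hlam hle k L' _ L _ hL0 hL β β' hW hW' hmatch Ω hΩ hpos hn heig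
  subst hL
  haveI : NeZero (2 ^ k) := ⟨pow_ne_zero _ two_ne_zero⟩
  have hβ' : 0 < β' := zero_lt_one.trans_le hW'.1
  -- coarse ground state `Ω' ≥ c' > 0` and first excited eigenfunction `φ'`
  obtain ⟨Ω', θ', c', hΩ', hc', hcle', hn', heig', -, -, -⟩ := PhysL2.exists_groundState (L := L') β'
  obtain ⟨e, hon, heige, -, -⟩ := exists_isPhys_eigenseq (L := L') hβ'
  set φ' : GaugeConfig 3 L' SU2 → ℝ := ((e 1 : physSubmodule L') : GaugeConfig 3 L' SU2 → ℝ) with hφ'def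
  have hφ' : IsPhys φ' := (e 1).2
  have hn1 : l2 φ' φ' = 1 := by have := hon 1 1; simpa using this
  have heig1 : transferApply β' φ' = secondValue su2Rep L' β' • φ' := by
    rw [← levelValue_one]; exact heige 1
  have horth : l2 φ' Ω' = 0 :=
    Dirichlet.l2_eq_zero_of_eigen_ne β' hφ' hΩ' heig1 heig' (PhysL2.secondValue_lt_topValue (L := L') β').ne
  -- pointwise eigen-equations (route vocabulary)
  have heigp : ∀ U, ∫ V, transferKernel su2Rep β U V * Ω V ∂(configMeasure SU2 (2 ^ k * L')) = topValue su2Rep (2 ^ k * L') β * Ω U :=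
    fun U => by simpa [transferApply] using congrFun heig U
  have heigp' : ∀ U', ∫ V', transferKernel su2Rep β' U' V' * Ω' V' ∂(configMeasure SU2 L') = topValue su2Rep L' β' * Ω' U' :=
    fun U => by simpa [transferApply] using congrFun heig' U
  have heigp1 : ∀ U', ∫ V', transferKernel su2Rep β' U' V' * φ' V' ∂(configMeasure SU2 L') = secondValue su2Rep L' β' * φ' U' :=
    fun U => by simpa [transferApply] using congrFun heig1 U
  -- the pinned statement
  have HB := H lam hlam hle k L' hL0 β β' hW hW' hmatch Ω hΩ hpos hn heigp Ω' hΩ' c' hc' hcle' hn' heigp' φ' hφ' horth hn1 heigp1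
  simp only [] at HB
  obtain ⟨hVar, hA, hineq⟩ := HB
  -- admissibility of the pinned multiplier, in the block-map vocabulary, then bridged
  obtain ⟨hrm, ⟨Cg, hrb⟩, hrg, hrz, -⟩ := Dirichlet.ratio_multiplier hΩ' hφ' hc' hcle'
  obtain ⟨hgm, hgb, hgg, hgz⟩ := Dirichlet.pullback_multiplier (M := 2 ^ k) (L' := L') hrm hrb hrg hrz
  simp only [transport_replicate_eq_prod_ofFn] at hgm hgb hgg hgz
  exact ⟨_, hgm, ⟨Cg, hgb⟩, hgg, hgz, hVar, hA, hineq⟩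

end Summit.QuantumFields.YangMills.Theorems.FemtoCutoffLadder

end
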